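import Summits.CriticalPhenomena.PercolationContinuityZ3.Theorems.Transplant.AutDiscreteWallSkeleton
import HarnessLib

/-!
# The END-STATE input on CAYLEY graphs: `vb₁(Γ) ≥ 2` is SUFFICIENT (any automorphism group) and, with a discrete automorphism group, NECESSARY —
# so the end-state node's reach on Cayley graphs with discrete `Aut` would be EXACTLY `vb₁(Γ) ≥ 2`

builds on p205010 (kernel theorem, internal audit signed; external expert review pending) — nothing in this file uses p205010; UNCONDITIONAL except, in
`criticalContinuity_of_endState`, the explicit hypothesis `hE` = END-STATE CONTINUITY (an OPEN statement of this programme, never asserted).  Lane `prim-bschramm`,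
seat `prim-bschramm-p4` gen 27 (PART C3 of `P4-GENERAL.md` §49.10).  Helper file (`--supports stmt-CriticalPhenomena-4575 --as helper`).  Def-free.

THE POINT.  Gen 26 proved that on a Cayley graph with DISCRETE automorphism group every node of the skeleton ladder forces `vb₁(Γ) ≥ 2` (a finite-index subgroup
with two independent characters) and that the one-type method is pinned between `b₁ ≥ 2` (sufficient) and `vb₁ ≥ 2` (necessary).  For the END-STATE input of gen 27
(a subgroup `A₀ ≤ Aut(G)` with finitely many orbits and a rank-two `ℤ²`-character killing every vertex stabiliser) the gap closes:
* **`EndStateCayley.exists_input_of_vb1`** — `Γ₀ ≤ Γ` of finite index with two independent characters `ψ₀, ψ₁ : Γ₀ → ℤ` ⟹ for EVERY finite `S` the Cayley graph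
  `Cay(Γ; S)` carries the end-state input: `A₀ = L(Γ₀)` (left translations by `Γ₀`: free, orbits = right cosets, finitely many), `c = (ψ₀, ψ₁) ∘ L⁻¹`.  NO assumption
  on `Aut`, growth or `S`.  Hence **`criticalContinuity_of_endState`**: end-state continuity ⟹ `θ(p_c) = 0` on EVERY Cayley graph of EVERY finitely generated group with
  `vb₁ ≥ 2` — in particular on the `vb₁ ≥ 2 > b₁` wall (ℤ²⋊C₄-type groups, the Hantzsche–Wendt group) and for every group of INTERMEDIATE growth with `vb₁ ≥ 2`.
* **`EndStateCayley.vb1_of_input`** — conversely, if `Cay(Γ; S)` has a FINITE `Aut`-stabiliser of `1` and carries the end-state input, then `Γ` has a subgroup of finite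
  index with a `ℤ²`-character of rank two (`vb₁(Γ) ≥ 2`) — gen 26's `AutDiscrete.offWall_descends_of_finite_orbits₂` applied to `A₀` and the left translations.
UPSHOT: on Cayley graphs with discrete automorphism group the end-state class is EXACTLY `vb₁(Γ) ≥ 2`; what no chart-and-frames node can reach there is exactly
`vb₁(Γ) ≤ 1` — torsion groups and the like (gen 26's no-go), all of intermediate or exponential growth, the latter being Hutchcroft's.  Nothing is claimed about any node.
[cite: BenjaminiSchramm1996, Conj. 4; §2 (Cayley graphs; almost transitive graphs)] [cite: GrimmettLi2017Amenability, Prop. 18] [cite: LeemannDelasalle2022, Cor. 1.3]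
-/

noncomputable section

namespace Summit.CriticalPhenomena.PercolationContinuityZ3.Theorems.Transplant

open SimpleGraph Literature.Barriers.CriticalPhenomena Literature.Probability.LatticeModels Literature.Probability.Percolation
open scoped Classical

namespace EndStateCayley

variable {Γ : Type} [Group Γ]

/-- **`vb₁(Γ) ≥ 2` ⟹ the end-state input on every Cayley graph of `Γ`**: `Γ₀ ≤ Γ` of finite index with independent characters `ψ₀, ψ₁` gives, on `Cay(Γ; S)` for
ANY finite `S`, the subgroup `L(Γ₀) ≤ Aut` of left translations (finitely many orbits = right cosets; free) with the rank-two character `(ψ₀, ψ₁) ∘ L⁻¹` killing every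
(trivial) stabiliser. [cite: BenjaminiSchramm1996, §2 (Cayley graphs)] [cite: GrimmettLi2017Amenability, Prop. 18] -/
theorem exists_input_of_vb1 (S : Finset Γ) (Γ₀ : Subgroup Γ) [Γ₀.FiniteIndex] (ψ₀ ψ₁ : Γ₀ →* Multiplicative ℤ) (a b : Γ₀)
    (hind : Multiplicative.toAdd (ψ₀ a) * Multiplicative.toAdd (ψ₁ b) ≠ Multiplicative.toAdd (ψ₁ a) * Multiplicative.toAdd (ψ₀ b)) :
    ∃ (A₀ : Subgroup (mulCayley (↑S : Set Γ) ≃g mulCayley (↑S : Set Γ))) (reps : Finset Γ) (c : A₀ →* Multiplicative (Site 2)),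
      (∀ w : Γ, ∃ x : A₀, ∃ s ∈ reps, (x : mulCayley (↑S : Set Γ) ≃g mulCayley (↑S : Set Γ)) s = w) ∧
      (∀ (x : A₀) (w : Γ), (x : mulCayley (↑S : Set Γ) ≃g mulCayley (↑S : Set Γ)) w = w → c x = 1) ∧
      ∃ x y : A₀, MaxArea.det2 (Multiplicative.toAdd (c x)) (Multiplicative.toAdd (c y)) ≠ 0 := by
  -- left translations as a homomorphism into `Aut(Cay(Γ; S))`
  let L : Γ →* (mulCayley (↑S : Set Γ) ≃g mulCayley (↑S : Set Γ)) :=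
    { toFun := leftMulIso S
      map_one' := RelIso.ext fun x => by show (1 : Γ) * x = x; exact one_mul x
      map_mul' := fun g h => RelIso.ext fun x => by show g * h * x = g * (h * x); exact mul_assoc g h x }
  have hL : ∀ g w : Γ, L g w = g * w := fun g w => rfl
  have hLinj : Function.Injective L := fun g h hgh => by
    have h1 := congrArg (fun e : mulCayley (↑S : Set Γ) ≃g mulCayley (↑S : Set Γ) => e 1) hgh
    simpa only [hL, mul_one] using h1
  set A₀ : Subgroup (mulCayley (↑S : Set Γ) ≃g mulCayley (↑S : Set Γ)) := Γ₀.map L with hA₀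
  let e : Γ₀ ≃* A₀ := Γ₀.equivMapOfInjective L hLinj
  have he : ∀ h : Γ₀, ((e h : A₀) : mulCayley (↑S : Set Γ) ≃g mulCayley (↑S : Set Γ)) = L h := fun h =>
    Subgroup.coe_equivMapOfInjective_apply Γ₀ L hLinj h
  let c : A₀ →* Multiplicative (Site 2) := (CayleyScaled.pairHom ψ₀ ψ₁).comp e.symm.toMonoidHom
  have hc : ∀ h : Γ₀, c (e h) = CayleyScaled.pairHom ψ₀ ψ₁ h := fun h => by
    show CayleyScaled.pairHom ψ₀ ψ₁ (e.symm (e h)) = _; rw [MulEquiv.symm_apply_apply]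
  -- right coset representatives: `w = (w ρ(w)⁻¹) ρ(w)` with `w ρ(w)⁻¹ ∈ Γ₀`
  let ρ : Γ → Γ := fun w => ((QuotientGroup.mk (w⁻¹) : Γ ⧸ Γ₀).out)⁻¹
  have hρ : ∀ w : Γ, w * (ρ w)⁻¹ ∈ Γ₀ := fun w => by
    obtain ⟨k, hk⟩ := QuotientGroup.mk_out_eq_mul Γ₀ w⁻¹
    show w * (((QuotientGroup.mk (w⁻¹) : Γ ⧸ Γ₀).out)⁻¹)⁻¹ ∈ Γ₀
    rw [inv_inv, hk, mul_inv_cancel_left]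
    exact k.2
  set reps : Finset Γ := (Set.finite_range fun q : Γ ⧸ Γ₀ => (q.out)⁻¹).toFinset with hreps
  have hρmem : ∀ w, ρ w ∈ reps := fun w => by rw [hreps, Set.Finite.mem_toFinset]; exact ⟨_, rfl⟩
  refine ⟨A₀, reps, c, fun w => ?_, fun x w hxw => ?_, ?_⟩
  · refine ⟨e ⟨w * (ρ w)⁻¹, hρ w⟩, ρ w, hρmem w, ?_⟩
    rw [he, hL]
    exact inv_mul_cancel_right w (ρ w)
  · -- the action is free: `x = e γ` with `γ w = w` forces `γ = 1`
    have hx : x = e (e.symm x) := (MulEquiv.apply_symm_apply e x).symm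
    have hγ : ((e.symm x : Γ₀) : Γ) = 1 := by
      have h1 : ((e (e.symm x) : A₀) : mulCayley (↑S : Set Γ) ≃g mulCayley (↑S : Set Γ)) w = w := by rw [← hx]; exact hxw
      rw [he, hL] at h1
      exact mul_eq_right.1 h1
    rw [hx, hc]
    have h1 : (e.symm x : Γ₀) = 1 := Subtype.ext hγ
    rw [h1, map_one]
  · refine ⟨e a, e b, ?_⟩
    rw [hc, hc, MaxArea.det2, CayleyScaled.toAdd_pairHom_zero, CayleyScaled.toAdd_pairHom_one, CayleyScaled.toAdd_pairHom_zero,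
      CayleyScaled.toAdd_pairHom_one]
    exact sub_ne_zero.2 hind

/-- **END-STATE CONTINUITY ⟹ `θ(p_c) = 0` on EVERY Cayley graph of EVERY finitely generated group with `vb₁ ≥ 2`** (a finite-index subgroup with two independent
characters) — the `vb₁ ≥ 2 > b₁` wall and every group of intermediate growth with `vb₁ ≥ 2` included; `p_c < 1` is automatic there.  `hE` is the explicit,
OPEN end-state statement (never asserted). [cite: BenjaminiSchramm1996, Conj. 4; §2 (Cayley graphs)] -/
theorem criticalContinuity_of_endState
    (hE : ∀ {W : Type} (G' : SimpleGraph W) [G'.LocallyFinite], G'.Connected →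
      ∀ (A₀ : Subgroup (G' ≃g G')) (reps : Finset W) (c : A₀ →* Multiplicative (Site 2)),
        (∀ w : W, ∃ a : A₀, ∃ s ∈ reps, (a : G' ≃g G') s = w) → (∀ (a : A₀) (w : W), (a : G' ≃g G') w = w → c a = 1) →
        (∃ a b : A₀, MaxArea.det2 (Multiplicative.toAdd (c a)) (Multiplicative.toAdd (c b)) ≠ 0) →
          ∀ x : W, theta G' x (criticalProbIOf G' x) = 0)
    (S : Finset Γ) (hS : Subgroup.closure (S : Set Γ) = ⊤) (Γ₀ : Subgroup Γ) [Γ₀.FiniteIndex] (ψ₀ ψ₁ : Γ₀ →* Multiplicative ℤ) (a b : Γ₀)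
    (hind : Multiplicative.toAdd (ψ₀ a) * Multiplicative.toAdd (ψ₁ b) ≠ Multiplicative.toAdd (ψ₁ a) * Multiplicative.toAdd (ψ₀ b)) (g : Γ) :
    theta (mulCayley (↑S : Set Γ)) g (criticalProbIOf (mulCayley (↑S : Set Γ)) g) = 0 := by
  obtain ⟨A₀, reps, c, h1, h2, h3⟩ := exists_input_of_vb1 S Γ₀ ψ₀ ψ₁ a b hind
  exact hE (mulCayley (↑S : Set Γ)) (CayleyScaled.connected_mulCayley_of_closure S hS) A₀ reps c h1 h2 h3 g

/-- **Conversely, with a DISCRETE automorphism group the end-state input forces `vb₁(Γ) ≥ 2`**: if `Cay(Γ; S)` has a finite `Aut`-stabiliser of `1` and carries a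
subgroup `A₀ ≤ Aut` with finitely many orbits and a rank-two `ℤ²`-character killing every vertex stabiliser, then `Γ` has a subgroup of FINITE INDEX with a
`ℤ²`-character of rank two (gen 26's descent `AutDiscrete.offWall_descends_of_finite_orbits₂` to the left translations, pulled back along `L`).
[cite: BenjaminiSchramm1996, §2 (Cayley graphs; almost transitive graphs)] [cite: GrimmettLi2017Amenability, Prop. 18] [cite: LeemannDelasalle2022, Cor. 1.3] -/
theorem vb1_of_input (S : Finset Γ) (hfin : {α : mulCayley (↑S : Set Γ) ≃g mulCayley (↑S : Set Γ) | α 1 = 1}.Finite)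
    (A₀ : Subgroup (mulCayley (↑S : Set Γ) ≃g mulCayley (↑S : Set Γ))) (reps : Finset Γ) (c : A₀ →* Multiplicative (Site 2))
    (horb : ∀ w : Γ, ∃ x : A₀, ∃ s ∈ reps, (x : mulCayley (↑S : Set Γ) ≃g mulCayley (↑S : Set Γ)) s = w)
    (hstab : ∀ (x : A₀) (w : Γ), (x : mulCayley (↑S : Set Γ) ≃g mulCayley (↑S : Set Γ)) w = w → c x = 1)
    (hrank : ∃ x y : A₀, MaxArea.det2 (Multiplicative.toAdd (c x)) (Multiplicative.toAdd (c y)) ≠ 0) :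
    ∃ Γ₁ : Subgroup Γ, Γ₁.FiniteIndex ∧ ∃ c₁ : Γ₁ →* Multiplicative (Site 2),
      ∃ x y : Γ₁, MaxArea.det2 (Multiplicative.toAdd (c₁ x)) (Multiplicative.toAdd (c₁ y)) ≠ 0 := by
  letI : MulAction (mulCayley (↑S : Set Γ) ≃g mulCayley (↑S : Set Γ)) Γ := AutChart.autMulAction (mulCayley (↑S : Set Γ))
  -- left translations
  let L : Γ →* (mulCayley (↑S : Set Γ) ≃g mulCayley (↑S : Set Γ)) :=
    { toFun := leftMulIso S
      map_one' := RelIso.ext fun x => by show (1 : Γ) * x = x; exact one_mul x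
      map_mul' := fun g h => RelIso.ext fun x => by show g * h * x = g * (h * x); exact mul_assoc g h x }
  have hL : ∀ g w : Γ, L g w = g * w := fun g w => rfl
  -- the finite stabiliser of `1`
  haveI : Finite (MulAction.stabilizer (mulCayley (↑S : Set Γ) ≃g mulCayley (↑S : Set Γ)) (1 : Γ)) := by
    have e : ((MulAction.stabilizer (mulCayley (↑S : Set Γ) ≃g mulCayley (↑S : Set Γ)) (1 : Γ) :
        Subgroup (mulCayley (↑S : Set Γ) ≃g mulCayley (↑S : Set Γ))) : Set (mulCayley (↑S : Set Γ) ≃g mulCayley (↑S : Set Γ))) =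
        {α : mulCayley (↑S : Set Γ) ≃g mulCayley (↑S : Set Γ) | α 1 = 1} := by
      ext α; exact MulAction.mem_stabilizer_iff
    have h : ((MulAction.stabilizer (mulCayley (↑S : Set Γ) ≃g mulCayley (↑S : Set Γ)) (1 : Γ) :
        Subgroup (mulCayley (↑S : Set Γ) ≃g mulCayley (↑S : Set Γ))) : Set (mulCayley (↑S : Set Γ) ≃g mulCayley (↑S : Set Γ))).Finite := by
      rw [e]; exact hfin
    exact h.to_subtype
  -- orbit representatives as automorphisms, and the transitive group of left translations
  have hX : ∀ b : mulCayley (↑S : Set Γ) ≃g mulCayley (↑S : Set Γ), ∃ x ∈ reps.image L, ∃ a ∈ A₀, a • x • (1 : Γ) = b • (1 : Γ) := fun b => by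
    obtain ⟨x, s, hs, hw⟩ := horb (b • (1 : Γ))
    refine ⟨L s, Finset.mem_image_of_mem L hs, x, x.2, ?_⟩
    show (x : mulCayley (↑S : Set Γ) ≃g mulCayley (↑S : Set Γ)) (L s 1) = b • (1 : Γ)
    rw [hL, mul_one]; exact hw
  have hY : ∀ b : mulCayley (↑S : Set Γ) ≃g mulCayley (↑S : Set Γ), ∃ y ∈ ({1} : Finset (mulCayley (↑S : Set Γ) ≃g mulCayley (↑S : Set Γ))),
      ∃ γ ∈ L.range, γ • y • (1 : Γ) = b • (1 : Γ) := fun b =>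
    ⟨1, Finset.mem_singleton_self _, L (b • (1 : Γ)), ⟨_, rfl⟩, by rw [one_smul]; show L (b • (1 : Γ)) 1 = b • (1 : Γ); rw [hL, mul_one]⟩
  set H : Subgroup (mulCayley (↑S : Set Γ) ≃g mulCayley (↑S : Set Γ)) := A₀ ⊓ L.range with hH
  obtain ⟨hne, -, c', -, x, y, hxy⟩ := AutDiscrete.offWall_descends_of_finite_orbits₂ A₀ L.range (reps.image L) {1} hX hY c
    (fun u h hh => hstab h u hh) hrank
  -- pull back along `L`
  refine ⟨H.comap L, ⟨?_⟩, c'.comp ((L.restrict (H.comap L)).codRestrict H fun γ => γ.2), ?_⟩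
  · rw [← Subgroup.relIndex_top_right, Subgroup.relIndex_comap, ← MonoidHom.range_eq_map]; exact hne
  · obtain ⟨γx, hγx⟩ : ∃ γ : Γ, L γ = (x : mulCayley (↑S : Set Γ) ≃g mulCayley (↑S : Set Γ)) := (inf_le_right (a := A₀) x.2 :)
    obtain ⟨γy, hγy⟩ : ∃ γ : Γ, L γ = (y : mulCayley (↑S : Set Γ) ≃g mulCayley (↑S : Set Γ)) := (inf_le_right (a := A₀) y.2 :)
    have hmx : γx ∈ H.comap L := by rw [Subgroup.mem_comap, hγx]; exact x.2
    have hmy : γy ∈ H.comap L := by rw [Subgroup.mem_comap, hγy]; exact y.2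
    have ex : ((L.restrict (H.comap L)).codRestrict H fun γ => γ.2) ⟨γx, hmx⟩ = x := Subtype.ext hγx
    have ey : ((L.restrict (H.comap L)).codRestrict H fun γ => γ.2) ⟨γy, hmy⟩ = y := Subtype.ext hγy
    exact ⟨⟨γx, hmx⟩, ⟨γy, hmy⟩, by rw [MonoidHom.comp_apply, MonoidHom.comp_apply, ex, ey]; exact hxy⟩

/-- **Hence, with a discrete automorphism group, the end-state input does not depend on the generating set**: an end-state input on ONE Cayley graph `Cay(Γ; S)` with
finite `Aut`-stabiliser of `1` gives `vb₁(Γ) ≥ 2` (`vb1_of_input`), hence an end-state input on EVERY Cayley graph `Cay(Γ; S')` (`exists_input_of_vb1`).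
[cite: BenjaminiSchramm1996, §2 (Cayley graphs)] [cite: LyonsPeres2016, §7.4 Thm. 7.15 (independence of the generating set)] -/
theorem exists_input_of_input (S S' : Finset Γ) (hfin : {α : mulCayley (↑S : Set Γ) ≃g mulCayley (↑S : Set Γ) | α 1 = 1}.Finite)
    (A₀ : Subgroup (mulCayley (↑S : Set Γ) ≃g mulCayley (↑S : Set Γ))) (reps : Finset Γ) (c : A₀ →* Multiplicative (Site 2))
    (horb : ∀ w : Γ, ∃ x : A₀, ∃ s ∈ reps, (x : mulCayley (↑S : Set Γ) ≃g mulCayley (↑S : Set Γ)) s = w)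
    (hstab : ∀ (x : A₀) (w : Γ), (x : mulCayley (↑S : Set Γ) ≃g mulCayley (↑S : Set Γ)) w = w → c x = 1)
    (hrank : ∃ x y : A₀, MaxArea.det2 (Multiplicative.toAdd (c x)) (Multiplicative.toAdd (c y)) ≠ 0) :
    ∃ (A₁ : Subgroup (mulCayley (↑S' : Set Γ) ≃g mulCayley (↑S' : Set Γ))) (reps' : Finset Γ) (c' : A₁ →* Multiplicative (Site 2)),
      (∀ w : Γ, ∃ x : A₁, ∃ s ∈ reps', (x : mulCayley (↑S' : Set Γ) ≃g mulCayley (↑S' : Set Γ)) s = w) ∧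
      (∀ (x : A₁) (w : Γ), (x : mulCayley (↑S' : Set Γ) ≃g mulCayley (↑S' : Set Γ)) w = w → c' x = 1) ∧
      ∃ x y : A₁, MaxArea.det2 (Multiplicative.toAdd (c' x)) (Multiplicative.toAdd (c' y)) ≠ 0 := by
  obtain ⟨Γ₁, hΓ₁, c₁, x, y, hxy⟩ := vb1_of_input S hfin A₀ reps c horb hstab hrank
  haveI := hΓ₁
  refine exists_input_of_vb1 S' Γ₁ ((Milnor.coordHom 0).comp c₁) ((Milnor.coordHom 1).comp c₁) x y ?_
  simp only [MonoidHom.comp_apply, Milnor.toAdd_coordHom]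
  intro h
  apply hxy
  rw [MaxArea.det2, h, sub_self]

end EndStateCayley

end Summit.CriticalPhenomena.PercolationContinuityZ3.Theorems.Transplant

end
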